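import Mathlib
import Literature.FieldTheory.Separability.PIndependentDerivations

/-!
# `PAlteration.PicoverToRadicialBottom`, line `theta-finite-cofinite-roots`: `p`-th root fields

Helper file of the line lead (stub `stub_cofiniteRegularTwist`). Fix a field `k` of
characteristic `p`, an extension `Ω` in which chosen `p`-th roots `θ a` (`(θ a)^p = a`) of all
`a ∈ k` exist, and for `T ⊆ k` the field `k(θ T) ⊆ Ω`. Proved here:

* `exists_mem_pAdjoin_algebraMap_eq_pow` — `p`-th powers of `k(θ T)` lie in `k^p(T)`;
* `root_not_mem_adjoin_roots` — if `b ∉ k^p(T)` then `θ b ∉ k(θ T)`;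
* `minpoly_root_eq_X_pow_sub_C` — then the minimal polynomial of `θ b` over `k(θ T)` is `X^p - b`;
* `exists_derivation_adjoin_roots_extends` — a derivation `δ` of `k` killing `T` extends to a
  derivation of `k(θ T)` (Zorn along `p`-th root extensions, `PartialDerivation`).
-/

noncomputable section

-- single-problem summit: the doubled namespace component `ResolutionOfSingularities` is forced
set_option linter.dupNamespace false

open Polynomial Literature.FieldTheory.Separability

namespace Summit.ResolutionOfSingularities.ResolutionOfSingularities.Theorems

section Roots

variable {p : ℕ} [Fact p.Prime] {k : Type} [Field k] [CharP k p] {Ω : Type} [Field Ω]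
  [Algebra k Ω] (θ : k → Ω)

/-- A derivation of a field of characteristic `p` killing `T` kills `k^p(T)`. [folklore] -/
theorem derivation_apply_eq_zero_of_mem_pAdjoin (δ : Derivation ℤ k k) {T : Set k}
    (hT : ∀ t ∈ T, δ t = 0) {y : k} (hy : y ∈ pAdjoin p T) : δ y = 0 := by
  have h : Set.EqOn δ (0 : Derivation ℤ k k) (Set.range (frobenius k p) ∪ T) := by
    rintro x (⟨z, rfl⟩ | hx)
    · rw [frobenius_def, Derivation.apply_pow_char (p := p)]
      rfl
    · rw [hT x hx]
      rfl
  exact Derivation.eqOn_subfieldClosure h hy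

variable (hθ : ∀ a : k, θ a ^ p = algebraMap k Ω a)
include hθ

/-- **`p`-th powers of `k(θ T)` lie in `k^p(T)`**: for `x ∈ k(θ T)` there is `y ∈ k^p(T)` with
`y = x^p` in `Ω`. [folklore] -/
theorem exists_mem_pAdjoin_algebraMap_eq_pow (T : Set k) {x : Ω}
    (hx : x ∈ IntermediateField.adjoin k (θ '' T)) :
    ∃ y ∈ pAdjoin p T, algebraMap k Ω y = x ^ p := by
  haveI : CharP Ω p := charP_of_injective_algebraMap (algebraMap k Ω).injective p
  induction hx using IntermediateField.adjoin_induction with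
  | mem x hx =>
    obtain ⟨t, ht, rfl⟩ := hx
    exact ⟨t, subset_pAdjoin _ ht, (hθ t).symm⟩
  | algebraMap a =>
    exact ⟨a ^ p, pow_mem_pAdjoin _ a, map_pow _ _ _⟩
  | add x y _ _ ihx ihy =>
    obtain ⟨a, ha, hax⟩ := ihx
    obtain ⟨b, hb, hby⟩ := ihy
    exact ⟨a + b, add_mem ha hb, by rw [map_add, hax, hby, add_pow_char]⟩
  | inv x _ ihx =>
    obtain ⟨a, ha, hax⟩ := ihx
    exact ⟨a⁻¹, inv_mem ha, by rw [map_inv₀, hax, inv_pow]⟩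
  | mul x y _ _ ihx ihy =>
    obtain ⟨a, ha, hax⟩ := ihx
    obtain ⟨b, hb, hby⟩ := ihy
    exact ⟨a * b, mul_mem ha hb, by rw [map_mul, hax, hby, mul_pow]⟩

/-- **If `b ∉ k^p(T)` then `θ b ∉ k(θ T)`.** [folklore] -/
theorem root_not_mem_adjoin_roots (T : Set k) {b : k} (hb : b ∉ pAdjoin p T) :
    θ b ∉ IntermediateField.adjoin k (θ '' T) := by
  intro hmem
  obtain ⟨y, hy, hyb⟩ := exists_mem_pAdjoin_algebraMap_eq_pow θ hθ T hmem
  rw [hθ b] at hyb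
  obtain rfl : y = b := (algebraMap k Ω).injective hyb
  exact hb hy

/-- No element of `k(θ T)` is a `p`-th root of `b ∉ k^p(T)`. [folklore] -/
theorem pow_ne_algebraMap_of_not_mem (T : Set k) {b : k} (hb : b ∉ pAdjoin p T)
    (y : IntermediateField.adjoin k (θ '' T)) :
    y ^ p ≠ algebraMap k (IntermediateField.adjoin k (θ '' T)) b := by
  haveI : CharP Ω p := charP_of_injective_algebraMap (algebraMap k Ω).injective p
  haveI : ExpChar Ω p := ExpChar.prime Fact.out
  intro h
  have h' : (y : Ω) ^ p = θ b ^ p := by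
    rw [hθ b]
    have := congrArg (algebraMap (IntermediateField.adjoin k (θ '' T)) Ω) h
    rwa [map_pow, ← IsScalarTower.algebraMap_apply] at this
  have hy : (y : Ω) = θ b := frobenius_inj Ω p h'
  exact root_not_mem_adjoin_roots θ hθ T hb (hy ▸ y.2)

/-- **The minimal polynomial of `θ b` over `k(θ T)` is `X^p - b`** when `b ∉ k^p(T)` (it is
irreducible as `b` has no `p`-th root in `k(θ T)`, Mathlib `X_pow_sub_C_irreducible_of_prime`).
[folklore] -/
theorem minpoly_root_eq_X_pow_sub_C (T : Set k) {b : k} (hb : b ∉ pAdjoin p T) :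
    minpoly (IntermediateField.adjoin k (θ '' T)) (θ b) =
      X ^ p - C (algebraMap k (IntermediateField.adjoin k (θ '' T)) b) := by
  set L := IntermediateField.adjoin k (θ '' T)
  have hirr : Irreducible (X ^ p - C (algebraMap k L b) : L[X]) :=
    X_pow_sub_C_irreducible_of_prime Fact.out (pow_ne_algebraMap_of_not_mem θ hθ T hb)
  have hmonic : (X ^ p - C (algebraMap k L b) : L[X]).Monic :=
    monic_X_pow_sub_C _ (Fact.out : p.Prime).ne_zero
  have haeval : aeval (θ b) (X ^ p - C (algebraMap k L b) : L[X]) = 0 := by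
    rw [map_sub, map_pow, aeval_X, aeval_C, ← IsScalarTower.algebraMap_apply, hθ b, sub_self]
  exact (minpoly.eq_of_irreducible_of_monic hirr haeval hmonic).symm

omit [CharP k p] in
/-- `θ b` is integral over `k(θ T)`. [folklore] -/
theorem isIntegral_root (T : Set k) (b : k) :
    IsIntegral (IntermediateField.adjoin k (θ '' T)) (θ b) := by
  refine ⟨X ^ p - C (algebraMap k _ b), monic_X_pow_sub_C _ (Fact.out : p.Prime).ne_zero, ?_⟩
  rw [eval₂_sub, eval₂_X_pow, eval₂_C, ← IsScalarTower.algebraMap_apply, hθ b, sub_self]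

/-- **A derivation of `k` killing `T` extends to `k(θ T)`**: for a derivation `δ` of `k` with
`δ = 0` on `T` there is a derivation `D` of the field `k(θ T)` with `D a = δ a` for `a ∈ k`
(Zorn's lemma along the `p`-th root extensions, `PartialDerivation.exists_extension_top`: the
partial derivation `a ↦ δ a` on `k ⊆ k(θ T)` kills all `p`-th powers of `k(θ T)`, which lie in
`k^p(T)`). [folklore] -/
theorem exists_derivation_adjoin_roots_extends (T : Set k) (δ : Derivation ℤ k k)
    (hT : ∀ t ∈ T, δ t = 0) :
    ∃ D : Derivation ℤ (IntermediateField.adjoin k (θ '' T))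
      (IntermediateField.adjoin k (θ '' T)),
      ∀ a : k, D (algebraMap k _ a) = algebraMap k _ (δ a) := by
  classical
  set L := IntermediateField.adjoin k (θ '' T)
  haveI : CharP L p := charP_of_injective_algebraMap (algebraMap k L).injective p
  let ι : k →+* L := algebraMap k L
  have hι : Function.Injective ι := ι.injective
  -- the `p`-th powers of `L` come from `k^p(T)`
  have hpow : ∀ x : L, ∃ y ∈ pAdjoin p T, ι y = x ^ p := fun x => by
    obtain ⟨y, hy, hyx⟩ := exists_mem_pAdjoin_algebraMap_eq_pow θ hθ T x.2
    refine ⟨y, hy, Subtype.ext ?_⟩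
    rw [IntermediateField.coe_pow]
    exact hyx
  -- the partial derivation `ι a ↦ ι (δ a)` on `ι(k)`
  let D₀ : L → L := fun x => if h : ∃ a, ι a = x then ι (δ h.choose) else 0
  have hD₀ : ∀ a : k, D₀ (ι a) = ι (δ a) := fun a => by
    have h : ∃ a', ι a' = ι a := ⟨a, rfl⟩
    simp only [D₀, dif_pos h]
    rw [hι h.choose_spec]
  let P₀ : PartialDerivation (E := L) p :=
    { F := ι.fieldRange
      D := D₀
      pow_mem := fun x => by
        obtain ⟨y, -, hy⟩ := hpow x
        exact ⟨y, hy⟩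
      apply_pow := fun x => by
        obtain ⟨y, hy, hyx⟩ := hpow x
        rw [← hyx, hD₀, derivation_apply_eq_zero_of_mem_pAdjoin δ hT hy, map_zero]
      apply_add := by
        rintro _ ⟨a, rfl⟩ _ ⟨b, rfl⟩
        change D₀ (ι a + ι b) = D₀ (ι a) + D₀ (ι b)
        rw [← map_add, hD₀, hD₀, hD₀, map_add, map_add]
      apply_mul := by
        rintro _ ⟨a, rfl⟩ _ ⟨b, rfl⟩
        change D₀ (ι a * ι b) = ι a * D₀ (ι b) + ι b * D₀ (ι a)
        rw [← map_mul, hD₀, hD₀, hD₀, Derivation.leibniz, smul_eq_mul, smul_eq_mul, map_add,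
          map_mul, map_mul] }
  obtain ⟨Q, hle, hQ⟩ := P₀.exists_extension_top
  refine ⟨Q.toDerivation hQ, fun a => ?_⟩
  change Q.D (ι a) = ι (δ a)
  rw [(PartialDerivation.le_def.mp hle).2 (ι a) ⟨a, rfl⟩]
  exact hD₀ a


end Roots

/-- **Registered form** of `exists_derivation_adjoin_roots_extends` (all binders explicit): a
derivation of `k` killing `T` extends to the `p`-th root field `k(θ T)`. [folklore] -/
theorem rootField_derivation_extends : ∀ (p : ℕ) [Fact p.Prime] (k : Type) [Field k] [CharP k p]
    (Ω : Type) [Field Ω] [Algebra k Ω] (θ : k → Ω), (∀ a : k, θ a ^ p = algebraMap k Ω a) →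
    ∀ (T : Set k) (δ : Derivation ℤ k k), (∀ t ∈ T, δ t = 0) →
    ∃ D : Derivation ℤ (IntermediateField.adjoin k (θ '' T)) (IntermediateField.adjoin k (θ '' T)),
      ∀ a : k, D (algebraMap k (IntermediateField.adjoin k (θ '' T)) a) =
        algebraMap k (IntermediateField.adjoin k (θ '' T)) (δ a) :=
  fun _ _ _ _ _ _ _ _ θ hθ T δ hT => exists_derivation_adjoin_roots_extends θ hθ T δ hT

end Summit.ResolutionOfSingularities.ResolutionOfSingularities.Theorems

end
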